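import Literature.AnabelianGeometry.EtaleTheta.Discharge.Sec4ThetaRootsThetaTwistTower
import Literature.AnabelianGeometry.EtaleTheta.Discharge.Sec5OfQuotientTemperoidData
import Literature.AnabelianGeometry.EtaleTheta.ThetaTwistTowerThetaCoordinate
import Literature.AnabelianGeometry.EtaleTheta.Discharge.Sec3Thm37Standard
import HarnessLib

/-!
# [EtTh] §5 — the FIRST §5 DATUM over a tower model: the data `(C, D, D_N → D, A_⊙ ← A_l ← A_N → B_N, s^⊓, s^⊔, σ, Π^tp_X ↠ Aut_D(B_N^bs), (l·Δ_Θ)_{(-)})` of §5 pp.326–331 (PDF pp.100–105) ASSEMBLED at the fourth tower model, theta function, fraction-pair, `l`-th root and `(l·Δ_Θ)`-stub CONSTRUCTED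

S. Mochizuki, *The étale theta function and its Frobenioid-theoretic manifestations*, Publ. RIMS **45** (2009)
[MochizukiEtTh2009], §5 pp.326–331 (PDF pp.100–105): «Let `(C, D, N, …)` be as in Definition 4.1 … the theta function determines an
element `Θ̈ ∈ O^×(A_⊙^birat)` … `l`-th roots `s′_l, s″_l` over `A_l` … `N`-th roots … `A_N → B_N` … the section `σ` … the natural
surjective outer homomorphism `Π^tp_X ↠ Aut_D(B_N^bs)` … `(l·Δ_Θ)_{B_N} ⊆ Aut_D(B_N^bs)`» (p.330 (PDF p.104) – p.331 (PDF p.105));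
Def. 4.1 p.312 (PDF p.86); Prop. 4.2 (iii) p.314 (PDF p.88); Prop. 4.3 (i) p.317 (PDF p.91); S. Mochizuki, *The geometry of
Frobenioids I* (2008) [MochizukiFrdI2008], Thm. 5.2 p.100.  [cite: MochizukiEtTh2009, §5 p.330–331 (PDF pp.104–105)]
PAGE CONVENTION for [EtTh]: «printed N (PDF p.M)», N = M + 226.

abc-iut cell, layer L2 = [EtTh], seat abc-iut-L2-t4 (gen 10; §5 typer / §5 junction lineage: `ofBiKummerData`,
`ofConnectedTemperoid*`, `Sec5OfThetaSetting`, Def. 5.4 files), KEY «JUNCTION ASSEMBLY — plan/L2/SUBDAG-EtTh-JUNCTION build-order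
STEP (5)» (abc-iut-L2-lead R1331 / R1339), FILE 1 of 2 (this file: the Type-1 carrier where the theta datum of record lives; FILE 2:
the small-index twin at the genuine `Π^tp_X̲̲` of a `ThetaSetting`).  ADDITIVE: nothing landed is edited or restated; every input is
consumed BY NAME.
* §1 **`hypotheses_temperedFrobenioid R S`** — the [FrdI] Thm. 5.2 standing hypotheses `h` (junction item D2) for abc-iut-L2-d2's
  fourth tower model `ThetaTwistTowerTempered.temperedFrobenioid` (p493549), NO hypothesis (abc-iut-L2-t3's recipe p504077:
  `hBinj` → `isMonoidOn_ratFnFunctor_of_isOfFSMType` → `hypotheses_treeCatVocab`).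
* §2 **`settingTheta R S n X φ hφ`** — the §4 setting of Def. 4.1 at the anchor `A_⊙ := (Compat₃′/V_n, 0) = Aodot R S n` (the
  domain of abc-iut-L2-d2's theta function `thetaUnit R S n`, A2 p507274) = abc-iut-L2-t3's `mkOfQuotientTemperoid(Quot)`
  along a DISPLAYED continuous surjection `φ : Π^tp_X ↠ Compat₃′` (junction item S2: design-only socket, abc-iut-L2-lead R1257;
  the continuous-`φ` repair is abc-iut-L2-t3's `settingClosureRange`, p510277), `H_⊙ = φ⁻¹(V_n)`.
* §3 **`firstDatum`** := abc-iut-L2-t3's `ThetaFrobenioid.ofQuotientTemperoidData` (p497260) with, per junction item: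
  D1 `pullFrac` generic · D2 `h := hypotheses_temperedFrobenioid` (THEOREM) · D3 `Q := ThetaCoord.thetaStub l` (abc-iut-L2-t4
  gen 9, p504128: the `Θ̈`-coordinate stub `(l·Δ_Θ)_{(-)}` of the tower, CONSTRUCTED) · D5 `θ := thetaUnit R S n`,
  `Pl := thetaFractionPair R S n …` (CONSTRUCTED, A2), `Rl` ANY `l`-th root (INHABITED: B1 p509012 `nonempty_nthRoot_theta`),
  `R : NthRoot Rl.root Rl.pair N` DISPLAYED (junction D5's one remaining datum-binder — print's nested «`N`-th root of the `l`-th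
  root», Rmk. 4.3.2 compatible choice = VNEXT N-P42III-DOMAIN; abc-iut-L2-lead R1339 (R-c) = (b3)) · D6a `hinvc := hinvc_theta`
  (THEOREM, B1) · D6b `hinvp` DISPLAYED (model-side input B2 p509439 `hθ'_thetaDen_of_φ₃_eq_one` holds exactly on `Ker(φ₃ ∘ φ)`;
  the subgroup transport is abc-iut-L2-d2's D6b-sub rider) · D4 `T : ThetaEnvData N`, `ιX : T.PiX ≃ₜ* X.Pi` DISPLAYED (genuine only
  at FILE 2) · D7 constants `(K', constEmb, inj)` DISPLAYED ○ — LABEL «degenerate-or-absent at this countable carrier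
  (abc-iut-L2-t11 p499346 / abc-iut-L2-lead R1155 J′); non-degenerate constants = abc-iut-L2-d3's base-field hull F2/F3» — never
  instantiated here, NOT counted.  Laws VERBATIM from p497260 (0 new mathematics): `StrvSection`, `SgpCapSpec`, `SgpCupSpec`,
  `SgpCapSection`, `AutAmpleBN` UNCONDITIONAL; `Facts ⟸ {hH, hconst, hgc}` with `hH ⟸ «φ(ιX(Π^tp_Ÿ)) ⊆ V_n»`; rfl dictionary.
* §4 **OF RECORD**: `thetaRootL` := THE `l`-th root of `(Θ̈; s′, s″)` chosen from B1 (`Classical.choice`), `firstDatumOfRecord` :=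
  `firstDatum` at `pullFrac := pullFracModel`, `Rl := thetaRootL`; its laws; `nonempty_nthRoot_theta … (l·N)` cited as the kernel
  witness of Prop. 5.2 (i)'s FIRST form («an `l·N`-th root of a right fraction-pair of `Θ̈`»).
HONEST FRAMING: the carrier is OUR class-(b) combinatorial DESIGN tower (`towerC₃sf`), NOT the tempered Frobenioid of a Tate curve;
`φ` onto `Compat₃′`, `hH`, `hinvp`, `R`, `T`/`ιX` and the constants are DISPLAYED hypotheses / data as labelled; what this datum COUNTS
for (Def. 5.4 / Prop. 5.5 / Thm. 5.6 / Thm. 5.7 cells) is the chair's ruling (R1072), not claimed here.  [EtTh]/[FrdI] are refereed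
prerequisite papers; nothing here bears on, or takes a side on, the disputed [IUTchIII] Cor. 3.12; nothing here asserts abc proved
or refuted; typed ≠ proved.
-/

noncomputable section

namespace Literature.AnabelianGeometry.EtaleTheta

open CategoryTheory Opposite Function Literature.AlgebraicGeometry.Frobenioids Literature.AlgebraicGeometry.Frobenioids.QuasiTemperoid
  Literature.AnabelianGeometry.SemiGraphs Literature.AnabelianGeometry.SemiGraphs.GaloisObjects LogDivisorModel
  LogDivisorModel.GaloisAction LogDivisorTower

namespace ThetaTwistTowerTempered

open LogDivisorModel.TateTowerThetaTwist TateTowerKummerTwistRShear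

variable (R S : ((ConnectedPart (BTemp (Compat 3 thetaShear)))ᵒᵖ ⥤ CommMonCat.{0}) → Prop)

/-! ## §1 The [FrdI] Thm. 5.2 standing hypotheses `h` for the fourth tower model (junction item D2) — NO hypothesis -/

/-- `hBinj` for the realified data `ofRlfZWeak dm hpf` of the fourth tower model: every pull-back of `B₀^Λ = B₀` along a map of
connected coverings is injective (abc-iut-L2-t3's `ofTower_B₀_map_injective`). [cite: MochizukiEtTh2009, Def 3.6 p.303 (PDF p.77)] -/
theorem hBinj_full {Y Y' : (ConnectedPart (BTemp (Compat 3 thetaShear)))ᵒᵖ} (g : Y ⟶ Y') :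
    Injective ((RealifiedDivisorMonoids.ofRlfZWeak dm hpf).BΛ.map g).hom :=
  RealifiedDivisorMonoids.ofRlfZWeak_hBinj dm hpf (fun g => towerC₃sf.ofTower_B₀_map_injective g) g

/-- **`hBmon`: `B` is a monoid on `B^temp(Compat₃′)⁰` for the fourth tower model** ([FrdI] Def. 1.1 (ii); `hBinj` + FSM-type base).
[cite: MochizukiEtTh2009, Def 3.6 p.303 (PDF p.77)] -/
theorem isMonoidOn_ratFnFunctor_full : IsMonoidOn (ThetaTwistTowerTempered.temperedFrobenioid R S).ratFnFunctor :=
  (ThetaTwistTowerTempered.temperedFrobenioid R S).isMonoidOn_ratFnFunctor_of_isOfFSMType (fun g => hBinj_full g)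
    QuasiTemperoid.BTempConnected.connectedPart_isOfFSMType

/-- **The [FrdI] Thm. 5.2 standing hypotheses HOLD for the Def. 3.6 (ii) data `(D, Φ, B, Div_B)` of the fourth tower model**
(`Φ` divisorial, `B` group-like, `D = B^temp(Compat₃′)⁰` connected and totally epimorphic) — the input `h` of the §5 datum
`ThetaFrobenioid.ofQuotientTemperoidData` (junction item D2), NO hypothesis. [cite: MochizukiFrdI2008, Thm. 5.2 p.100] -/
theorem hypotheses_temperedFrobenioid :
    ModelFrobenioid.Hypotheses (ThetaTwistTowerTempered.temperedFrobenioid R S).divisorMonoid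
      (ThetaTwistTowerTempered.temperedFrobenioid R S).ratFnFunctor :=
  (ThetaTwistTowerTempered.temperedFrobenioid R S).hypotheses_treeCatVocab (isMonoidOn_ratFnFunctor_full R S)

/-- In particular `Φ(A)` is divisorial at every connected covering `A` (the `hΦd` slot of the §4/§5 law-level closers).
[cite: MochizukiFrdI2008, Thm. 5.2 p.100] -/
theorem isDivisorial_full (A : ConnectedPart (BTemp (Compat 3 thetaShear))) :
    IsDivisorial ((ThetaTwistTowerTempered.temperedFrobenioid R S).divisorMonoid.obj (op A)) :=
  (hypotheses_temperedFrobenioid R S).isDivisorial A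

/-! ## §2 The §4 setting at the anchor `A_⊙ := (Compat₃′/V_n, 0)` — the domain of the theta function (junction items S1–S3) -/

variable (n : ℕ) {K : Type 1} [Field K] (X : SemiGraphs.TemperedArithmeticGroup.{1} K)
  (φ : X.Pi →ₜ* Compat 3 thetaShear) (hφ : Function.Surjective φ)

/-- **The §4 setting of Def. 4.1 over the fourth tower model at `A_⊙ := (Compat₃′/V_n, 0)`** along the DISPLAYED continuous
surjection `φ : Π^tp_X ↠ Compat₃′` (abc-iut-L2-t3's `mkOfQuotientTemperoid`, spelled exactly as in abc-iut-L2-d2's B1 so that the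
theta datum's types match syntactically; `(N, H)`-slot trivial). [cite: MochizukiEtTh2009, Def 4.1 p.312 (PDF p.86)] -/
abbrev settingTheta : BiKummerSetting X (RealifiedDivisorMonoids.ofRlfZWeak dm hpf) (ConnectedPart (BTemp (Compat 3 thetaShear)))
    (treeCatVocab (ConnectedPart (BTemp (Compat 3 thetaShear))) R S) :=
  BiKummerSetting.mkOfQuotientTemperoid X (isTemperedC 3 thetaShear) φ hφ (ThetaTwistTowerTempered.temperedFrobenioid R S)
    (monoidType_eq R S) (hP R S) (fun _ _ _ => True)
    ((ThetaTwistTowerTempered.temperedFrobenioid R S).quotConnZeroObj (isTemperedC 3 thetaShear) (vOpenNormal 3 thetaShear n))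
    ((ThetaTwistTowerTempered.temperedFrobenioid R S).isFrobeniusTrivial_quotConnZeroObj (isTemperedC 3 thetaShear)
      (vOpenNormal 3 thetaShear n))
    ((ThetaTwistTowerTempered.temperedFrobenioid R S).isGaloisObj_quotConnZeroObj_base (isTemperedC 3 thetaShear)
      (vOpenNormal 3 thetaShear n))

/-- It IS abc-iut-L2-t3's `mkOfQuotientTemperoidQuot` at `M := V_n` (definitionally). [cite: MochizukiEtTh2009, Def 4.1 p.312 (PDF p.86)] -/
theorem settingTheta_eq_quot : settingTheta R S n X φ hφ =
    BiKummerSetting.mkOfQuotientTemperoidQuot X (isTemperedC 3 thetaShear) φ hφ (ThetaTwistTowerTempered.temperedFrobenioid R S)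
      (monoidType_eq R S) (hP R S) (fun _ _ _ => True) (vOpenNormal 3 thetaShear n) := rfl

/-- Its tempered Frobenioid is the fourth tower model (definitionally). [cite: MochizukiEtTh2009, Def 4.1 p.312 (PDF p.86)] -/
theorem settingTheta_tf : (settingTheta R S n X φ hφ).tf = ThetaTwistTowerTempered.temperedFrobenioid R S := rfl

/-- Its anchor `A_⊙` is `Aodot R S n = (Y_n, 0)`, the domain of `Θ̈` (definitionally). [cite: MochizukiEtTh2009, Def 4.1 p.312 (PDF p.86)] -/
theorem settingTheta_Aodot : (settingTheta R S n X φ hφ).Aodot = Aodot R S n := rfl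

/-- **`H_⊙ = φ⁻¹(V_n)`.** [cite: MochizukiEtTh2009, Def 4.1 p.312 (PDF p.86)] -/
theorem settingTheta_Hodot : (settingTheta R S n X φ hφ).Hodot = (vOpenNormal 3 thetaShear n).toSubgroup.comap φ.toMonoidHom :=
  BiKummerSetting.Hodot_mkOfQuotientTemperoidQuot X (isTemperedC 3 thetaShear) φ hφ _ (monoidType_eq R S) (hP R S) _ _

/-- **The §5 binder `hH` (`Π^tp_Ÿ ⊆ H_⊙`) at this anchor ⟸ «`φ(ιX(Π^tp_Ÿ)) ⊆ V_n`»** (a level clause on the displayed `φ`).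
[cite: MochizukiEtTh2009, §5 p.330 (PDF p.104)] -/
theorem hH_settingTheta_of_forall_mem {P : Type*} [Group P] [TopologicalSpace P] (ιX : P ≃ₜ* X.Pi) (PiYdd : Subgroup P)
    (hM : ∀ y : P, y ∈ PiYdd → φ (ιX y) ∈ vOpenNormal 3 thetaShear n) :
    ∀ y : P, y ∈ PiYdd → ιX y ∈ (settingTheta R S n X φ hφ).Hodot :=
  BiKummerSetting.hH_mkOfQuotientTemperoidQuot_of_forall_mem X (isTemperedC 3 thetaShear) φ hφ _ (monoidType_eq R S) (hP R S) _ _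
    ιX PiYdd hM

/-- Def. 4.1 (ii) naturality for the setting: a THEOREM (abc-iut-L2-t3). [cite: MochizukiEtTh2009, Def 4.1 (ii) p.313 (PDF p.87)] -/
theorem settingTheta_galoisSurjNatural : (settingTheta R S n X φ hφ).GaloisSurjNatural :=
  BiKummerSetting.mkOfQuotientTemperoid_galoisSurj_natural X (isTemperedC 3 thetaShear) φ hφ _ (monoidType_eq R S) (hP R S) _ _ _ _

/-- Def. 4.1 (ii) open kernels for the setting: a THEOREM (abc-iut-L2-t3). [cite: MochizukiEtTh2009, Def 4.1 (ii) p.313 (PDF p.87)] -/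
theorem settingTheta_isOpenKerGaloisSurj : (settingTheta R S n X φ hφ).IsOpenKerGaloisSurj :=
  BiKummerSetting.mkOfQuotientTemperoid_isOpen_ker_galoisSurj X (isTemperedC 3 thetaShear) φ hφ _ (monoidType_eq R S) (hP R S) _
    _ _ _

/-! ## §3 The §5 datum ASSEMBLED (junction items D1–D8) -/

variable {lv N : ℕ+} (T : ThetaEnvData.{0} N)
  {pullFrac : ∀ {A A' : (ThetaTwistTowerTempered.temperedFrobenioid R S).category} (_ : A' ⟶ A),
    (ThetaTwistTowerTempered.temperedFrobenioid R S).biratUnitsModel A →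
      (ThetaTwistTowerTempered.temperedFrobenioid R S).biratUnitsModel A'}
  (Rl : (settingTheta R S n X φ hφ).NthRoot (thetaUnit R S n)
    (thetaFractionPair R S n X _ _ _ (fun _ _ _ => True) _ (isFrobeniusTrivial_Aodot R S n) (isGaloisObj_Aodot_base R S n)) lv
    pullFrac)
  (Rt : (settingTheta R S n X φ hφ).NthRoot Rl.root Rl.pair N pullFrac)
  (odd_l : Odd (lv : ℕ)) (ιX : T.PiX ≃ₜ* X.Pi) (K' : Type) [Field K']
  (constEmb : K'ˣ →* (ThetaTwistTowerTempered.temperedFrobenioid R S).biratUnitsModel Rt.BN)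
  (constEmb_injective : Injective constEmb)
  (hinvp : ∀ y : T.PiX, y ∈ T.PiYdd →
    pull (ThetaTwistTowerTempered.temperedFrobenioid R S).divisorMonoid
      ((settingTheta R S n X φ hφ).galoisSurj Rt.AN.base Rt.αData.isGalois (ιX y)).hom (ModelFrobenioid.div Rt.pair.den) =
      ModelFrobenioid.div Rt.pair.den)

/-- **THE FIRST §5 DATUM OVER A TOWER MODEL** — the [EtTh] §5 data (pp.330–331 (PDF pp.104–105)) over `B^temp(Compat₃′)⁰` at the
fourth tower model: `A_⊙ = (Y_n, 0)`, `Θ̈ = thetaUnit R S n ∈ O^×(A_⊙^birat)`, fraction-pair `(s′, s″) = thetaFractionPair`, an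
`l`-th root `Rl` (`A_l, B_l, s′_l, s″_l`) and an `N`-th root `R` of it (`A_N → B_N, s^⊓_N, s^⊔_N`), `σ = s^trv_N` CONSTRUCTED,
`Π^tp_X ↠ Aut_D(B_N^bs)` from `φ`, `(l·Δ_Θ)_{(-)} := thetaStub l` (the `Θ̈`-coordinate stub), `hinvc` a THEOREM (`hinvc_theta`);
DISPLAYED: `φ` onto, `R`, `T`/`ιX`, the constants `(K', constEmb)` ○ (degenerate-or-absent at this countable carrier — LABEL, not
counted), `hinvp`. [cite: MochizukiEtTh2009, §5 p.330–331 (PDF pp.104–105)] -/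
def firstDatum : ThetaFrobenioid.{0} (settingTheta R S n X φ hφ).C (ConnectedPart (BTemp (Compat 3 thetaShear))) :=
  ThetaFrobenioid.ofQuotientTemperoidData (hypotheses_temperedFrobenioid R S) (ThetaCoord.thetaStub (lv : ℕ)) odd_l Rt ιX K'
    constEmb constEmb_injective (hinvc_theta R S n X φ hφ Rl Rt) hinvp

/-- `firstDatum` unfolds to abc-iut-L2-t3's `ofQuotientTemperoidData` with the constructed arguments (definitionally) — every theorem
of `Discharge/Sec5OfQuotientTemperoidData.lean`, `FrobenioidThetaOfBiKummerData.lean`, `Discharge/Sec5OfModelData.lean` applies verbatim.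
[cite: MochizukiEtTh2009, §5 p.330–331 (PDF pp.104–105)] -/
theorem firstDatum_eq : firstDatum R S n X φ hφ T Rl Rt odd_l ιX K' constEmb constEmb_injective hinvp =
    ThetaFrobenioid.ofQuotientTemperoidData (hypotheses_temperedFrobenioid R S) (ThetaCoord.thetaStub (lv : ℕ)) odd_l Rt ιX K'
      constEmb constEmb_injective (hinvc_theta R S n X φ hφ Rl Rt) hinvp := rfl

/-- The tempered group `Π^tp_X` of the datum is that of the §2 datum `T`. [cite: MochizukiEtTh2009, §5 p.331 (PDF p.105)] -/
theorem firstDatum_PiX : (firstDatum R S n X φ hφ T Rl Rt odd_l ιX K' constEmb constEmb_injective hinvp).PiX = T.PiX := rfl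

/-- `A_⊙` of the datum is `(Y_n, 0)`, the domain of `Θ̈`. [cite: MochizukiEtTh2009, §5 p.330 (PDF p.104)] -/
theorem firstDatum_Acirc : (firstDatum R S n X φ hφ T Rl Rt odd_l ιX K' constEmb constEmb_injective hinvp).Acirc = Aodot R S n := rfl

/-- `Θ̈` of the datum is abc-iut-L2-d2's theta function `thetaUnit R S n ∈ O^×(A_⊙^birat)`. [cite: MochizukiEtTh2009, §5 p.330 (PDF p.104)] -/
theorem firstDatum_thetaFn :
    (firstDatum R S n X φ hφ T Rl Rt odd_l ιX K' constEmb constEmb_injective hinvp).thetaFn = thetaUnit R S n := rfl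

/-- `A_N` of the datum is the root's `A_N`. [cite: MochizukiEtTh2009, §5 p.330 (PDF p.104)] -/
theorem firstDatum_AN : (firstDatum R S n X φ hφ T Rl Rt odd_l ιX K' constEmb constEmb_injective hinvp).AN = Rt.AN := rfl

/-- `B_N` of the datum is the root's `B_N`. [cite: MochizukiEtTh2009, §5 p.330 (PDF p.104)] -/
theorem firstDatum_BN : (firstDatum R S n X φ hφ T Rl Rt odd_l ιX K' constEmb constEmb_injective hinvp).BN = Rt.BN := rfl

/-- `s^⊓_N` of the datum is the root's numerator. [cite: MochizukiEtTh2009, §5 p.330 (PDF p.104)] -/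
theorem firstDatum_sCap : (firstDatum R S n X φ hφ T Rl Rt odd_l ιX K' constEmb constEmb_injective hinvp).sCap = Rt.pair.num := rfl

/-- `s^⊔_N` of the datum is the root's denominator. [cite: MochizukiEtTh2009, §5 p.330 (PDF p.104)] -/
theorem firstDatum_sCup : (firstDatum R S n X φ hφ T Rl Rt odd_l ιX K' constEmb constEmb_injective hinvp).sCup = Rt.pair.den := rfl

/-- `(l·Δ_Θ)_E` of the datum is the `Θ̈`-coordinate stub `thetaStub l` (abc-iut-L2-t4 gen 9) at every connected covering `E` — so
Def. 5.4 (b) at a tower object `Y_{m+1}` reads through `card_lDelta_thetaStub_quotient_pow_eq_iff` (p504739).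
[cite: MochizukiEtTh2009, §5 p.327 (PDF p.101); Def 5.4 p.327 (PDF p.101)] -/
theorem firstDatum_lDelta (E : ConnectedPart (BTemp (Compat 3 thetaShear))) :
    (firstDatum R S n X φ hφ T Rl Rt odd_l ιX K' constEmb constEmb_injective hinvp).lDelta E =
      (ThetaCoord.thetaStub (lv : ℕ)).lDelta E := rfl

/-- `l`, `N`, `K` of the datum are `lv`, `N`, `K'`. [cite: MochizukiEtTh2009, §5 p.326 (PDF p.100)] -/
theorem firstDatum_l_N_K : (firstDatum R S n X φ hφ T Rl Rt odd_l ιX K' constEmb constEmb_injective hinvp).l = lv ∧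
    (firstDatum R S n X φ hφ T Rl Rt odd_l ιX K' constEmb constEmb_injective hinvp).N = N ∧
    (firstDatum R S n X φ hφ T Rl Rt odd_l ιX K' constEmb constEmb_injective hinvp).K = K' := ⟨rfl, rfl, rfl⟩

/-- `s^trv_N` of the datum is the CONSTRUCTED section ([FrdI] Prop. 5.6). [cite: MochizukiEtTh2009, §5 p.331 (PDF p.105)] -/
theorem firstDatum_strv : (firstDatum R S n X φ hφ T Rl Rt odd_l ιX K' constEmb constEmb_injective hinvp).strv =
    ThetaFrobenioid.strvOfBiKummerData (hypotheses_temperedFrobenioid R S) Rt := rfl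

/-- **`StrvSection` holds UNCONDITIONALLY** at the first datum (`σ` constructed). [cite: MochizukiEtTh2009, §5 p.331 (PDF p.105)] -/
theorem strvSection_firstDatum : (firstDatum R S n X φ hφ T Rl Rt odd_l ιX K' constEmb constEmb_injective hinvp).StrvSection :=
  ThetaFrobenioid.strvSection_ofQuotientTemperoidData (hypotheses_temperedFrobenioid R S) (ThetaCoord.thetaStub (lv : ℕ)) odd_l Rt ιX
    K' constEmb constEmb_injective (hinvc_theta R S n X φ hφ Rl Rt) hinvp

/-- **`SgpCapSpec` holds** at the first datum. [cite: MochizukiEtTh2009, §5 p.331 (PDF p.105)] -/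
theorem sgpCapSpec_firstDatum : (firstDatum R S n X φ hφ T Rl Rt odd_l ιX K' constEmb constEmb_injective hinvp).SgpCapSpec :=
  ThetaFrobenioid.sgpCapSpec_ofQuotientTemperoidData (hypotheses_temperedFrobenioid R S) (ThetaCoord.thetaStub (lv : ℕ)) odd_l Rt ιX
    K' constEmb constEmb_injective (hinvc_theta R S n X φ hφ Rl Rt) hinvp

/-- **`SgpCupSpec` holds** at the first datum. [cite: MochizukiEtTh2009, §5 p.331 (PDF p.105)] -/
theorem sgpCupSpec_firstDatum : (firstDatum R S n X φ hφ T Rl Rt odd_l ιX K' constEmb constEmb_injective hinvp).SgpCupSpec :=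
  ThetaFrobenioid.sgpCupSpec_ofQuotientTemperoidData (hypotheses_temperedFrobenioid R S) (ThetaCoord.thetaStub (lv : ℕ)) odd_l Rt ιX
    K' constEmb constEmb_injective (hinvc_theta R S n X φ hφ Rl Rt) hinvp

/-- **`SgpCapSection` holds** at the first datum. [cite: MochizukiEtTh2009, §5 p.331 (PDF p.105)] -/
theorem sgpCapSection_firstDatum :
    (firstDatum R S n X φ hφ T Rl Rt odd_l ιX K' constEmb constEmb_injective hinvp).SgpCapSection :=
  ThetaFrobenioid.sgpCapSection_ofQuotientTemperoidData (hypotheses_temperedFrobenioid R S) (ThetaCoord.thetaStub (lv : ℕ)) odd_l Rt ιX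
    K' constEmb constEmb_injective (hinvc_theta R S n X φ hφ Rl Rt) hinvp

/-- **`B_N` is Aut-ample** at the first datum («it follows that `B_N` is Aut-ample», p.330 (PDF p.104)).
[cite: MochizukiEtTh2009, §5 p.330 (PDF p.104)] -/
theorem autAmpleBN_firstDatum : (firstDatum R S n X φ hφ T Rl Rt odd_l ιX K' constEmb constEmb_injective hinvp).AutAmpleBN :=
  ThetaFrobenioid.autAmpleBN_ofQuotientTemperoidData (hypotheses_temperedFrobenioid R S) (ThetaCoord.thetaStub (lv : ℕ)) odd_l Rt ιX
    K' constEmb constEmb_injective (hinvc_theta R S n X φ hφ Rl Rt) hinvp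

-- ELABORATION NOTE (measured on the farm): each occurrence of the anchor mismatch `Aodot R S n` (abc-iut-L2-d2) vs
-- `quotConnZeroObj … (vOpenNormal n)` (abc-iut-L2-t3) costs ≈ 10⁵ heartbeats of `whnf`; the two declarations below exceed the default
-- budget only by re-elaborating the section variables — 400000 suffices (precedent: `Sec5PsiAutBiKummerDiffOfBiKummerData`).
-- Consumers: pass `pullFrac` as a free variable or as `(pullFrac := fun {_} {_} ψ x => …)`; inferring it from a root's type times out.
set_option maxHeartbeats 400000 in
/-- **`Facts` at the first datum ⟸ {the level clause «`φ(ιX(Π^tp_Ÿ)) ⊆ V_n`» (giving `hH`), `hconst` (Def. 3.6 (iii)), `hgc`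
(Lemma 5.8's geometric connectedness)}** — every other §5 named input a THEOREM here (abc-iut-L2-t3's `facts_ofQuotientTemperoidData`;
`𝔉 = firstDatum …` abbreviates the `hgc` binder as in abc-iut-L2-t9's `facts_ofModelData_of_geomConnected`).
[cite: MochizukiEtTh2009, §5 p.330–331 (PDF pp.104–105)] -/
theorem facts_firstDatum (hM : ∀ y : T.PiX, y ∈ T.PiYdd → φ (ιX y) ∈ vOpenNormal 3 thetaShear n)
    (hconst : ∀ (e : Aut Rt.BN) (k : K'ˣ),
      (ThetaTwistTowerTempered.temperedFrobenioid R S).biratAutModel Rt.BN e (constEmb k) = constEmb k)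
    {𝔉 : ThetaFrobenioid.{0} (settingTheta R S n X φ hφ).C (ConnectedPart (BTemp (Compat 3 thetaShear)))}
    (h𝔉 : 𝔉 = firstDatum R S n X φ hφ T Rl Rt odd_l ιX K' constEmb constEmb_injective hinvp)
    (hgc : ∀ u : 𝔉.units 𝔉.BN, (∀ y ∈ 𝔉.imPiY, 𝔉.sgpCap y * (u : Aut 𝔉.BN) * (𝔉.sgpCap y)⁻¹ = u) →
      𝔉.unitsToBirat 𝔉.BN u ∈ 𝔉.constEmb.range) :
    𝔉.Facts := by
  subst h𝔉
  exact ThetaFrobenioid.facts_ofQuotientTemperoidData (hypotheses_temperedFrobenioid R S) (ThetaCoord.thetaStub (lv : ℕ)) odd_l Rt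
    ιX K' constEmb constEmb_injective (hinvc_theta R S n X φ hφ Rl Rt) hinvp
    (hH_settingTheta_of_forall_mem R S n X φ hφ ιX T.PiYdd hM) hconst hgc

/-! ## §4 OF RECORD: the chosen `l`-th root of `(Θ̈; s′, s″)` and the datum over it -/

variable (l : ℕ+)

/-- **THE `l`-th root `(A_l, B_l, s′_l, s″_l)` of the theta function's fraction-pair OF RECORD** — chosen (`Classical.choice`) from
abc-iut-L2-d2's Prop. 4.2 (iii) instance at the fourth model (B1 `nonempty_nthRoot_theta`, p509012), `pullFrac := pullFracModel`.
[cite: MochizukiEtTh2009, §5 p.330 (PDF p.104); Prop 4.2 (iii) p.314 (PDF p.88)] -/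
def thetaRootL : (settingTheta R S n X φ hφ).NthRoot (thetaUnit R S n)
    (thetaFractionPair R S n X _ _ _ (fun _ _ _ => True) _ (isFrobeniusTrivial_Aodot R S n) (isGaloisObj_Aodot_base R S n)) l
    (fun {_} ψ x => (ThetaTwistTowerTempered.temperedFrobenioid R S).pullFracModel ψ x) :=
  (nonempty_nthRoot_theta R S n X φ hφ l).some

variable (Rr : (settingTheta R S n X φ hφ).NthRoot (thetaRootL R S n X φ hφ l).root (thetaRootL R S n X φ hφ l).pair N
    (fun {_} ψ x => (ThetaTwistTowerTempered.temperedFrobenioid R S).pullFracModel ψ x))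
  (odd_l' : Odd (l : ℕ)) (constEmb' : K'ˣ →* (ThetaTwistTowerTempered.temperedFrobenioid R S).biratUnitsModel Rr.BN)
  (constEmb'_injective : Injective constEmb')
  (hinvp' : ∀ y : T.PiX, y ∈ T.PiYdd →
    pull (ThetaTwistTowerTempered.temperedFrobenioid R S).divisorMonoid
      ((settingTheta R S n X φ hφ).galoisSurj Rr.AN.base Rr.αData.isGalois (ιX y)).hom (ModelFrobenioid.div Rr.pair.den) =
      ModelFrobenioid.div Rr.pair.den)

set_option maxHeartbeats 400000 in -- see the ELABORATION NOTE in §3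
/-- **THE FIRST §5 DATUM OF RECORD** = `firstDatum` at `pullFrac := pullFracModel`, `Rl := thetaRootL` (the chosen `l`-th root)
ELABORATES, and e.g. `StrvSection` holds there with NO hypothesis beyond the displayed data (the `N`-th root `Rr` of `thetaRootL` =
junction D5's one remaining datum-binder, `T`/`ιX`, constants ○, `hinvp`); the other laws are §3's theorems at these arguments.
[cite: MochizukiEtTh2009, §5 p.331 (PDF p.105)] -/
theorem strvSection_firstDatum_thetaRootL :
    (firstDatum R S n X φ hφ T (pullFrac := fun {_} {_} ψ x => (ThetaTwistTowerTempered.temperedFrobenioid R S).pullFracModel ψ x)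
      (thetaRootL R S n X φ hφ l) Rr odd_l' ιX K' constEmb' constEmb'_injective hinvp').StrvSection :=
  strvSection_firstDatum R S n X φ hφ T
    (pullFrac := fun {_} {_} ψ x => (ThetaTwistTowerTempered.temperedFrobenioid R S).pullFracModel ψ x)
    (thetaRootL R S n X φ hφ l) Rr odd_l' ιX K' constEmb' constEmb'_injective hinvp'

/-- **Prop. 5.2 (i), FIRST form, kernel-witnessed at the datum's theta function**: «an `l·N`-th root of a right fraction-pair of
`Θ̈`» EXISTS (abc-iut-L2-d2's B1 at `N := l·N`); the NESTED `N`-th root `Rr` of the `l`-th root stays displayed (Rmk. 4.3.2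
«compatible choice»). [cite: MochizukiEtTh2009, Prop 5.2 (i) p.324 (PDF p.98)] -/
theorem nonempty_nthRoot_theta_mul :
    Nonempty ((settingTheta R S n X φ hφ).NthRoot (thetaUnit R S n)
      (thetaFractionPair R S n X _ _ _ (fun _ _ _ => True) _ (isFrobeniusTrivial_Aodot R S n) (isGaloisObj_Aodot_base R S n))
      (l * N) (fun {_} ψ x => (ThetaTwistTowerTempered.temperedFrobenioid R S).pullFracModel ψ x)) :=
  nonempty_nthRoot_theta R S n X φ hφ (l * N)

end ThetaTwistTowerTempered

end Literature.AnabelianGeometry.EtaleTheta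

end
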